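import Mathlib
import Summits.Ventures.Crystal3D.Theorems.StickyWulffConstantLayerChainDefs
import Summits.Ventures.Crystal3D.Theorems.StickyWulffConstantStackingLiminfLayerChainV4Defs
import Summits.Ventures.Crystal3D.Theorems.StickyWulffConstantStackingLiminfMollifierSmooth
import Summits.Ventures.Crystal3D.Theorems.StickyWulffConstantStackingLiminfKernelBounds
import Summits.Ventures.Crystal3D.Theorems.StickyWulffConstantStackingLiminfLateralCalculus
import Summits.Ventures.Crystal3D.Theorems.StickyWulffConstantStackingLiminfStackTensionContinuity
import HarnessLib

/-!
# Layer bookkeeping for stub (B) `MollifiedUpper` (line LayerChain v4, crux `StackingLiminf`,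
# stmt-Ventures-19145): the mollified densities split over a padded range of layers

Cell `crystal3d-full`, venture `Summits/Ventures/Crystal3D`.  Small facts the integrated two-phase pairing
needs to decompose `dens x K`, `smooth x K L` and `negGrad (smooth x K L)` into layer contributions indexed by
a PADDED range `k = k₀ + n`, `n < m` (so that the layer differences telescope to zero), plus the sup-norm
bounds `‖a_m‖, ‖b⁺_m‖, ‖b⁻_m‖ ≤ 1`, the horizontality `(b⁺_i − b⁻_i)₂ = 0` and `dot3` symmetry.
* `exists_layerMap` — every configuration in a Barlow stacking has a layer map `kf` with `(x i)₂ = kf i · √(2/3)`;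
* `sum_eq_sum_range_layers` — `Σ_i g i = Σ_{n<m} Σ_{i : kf i = k₀+n} g i` when all layers lie in `[k₀, k₀+m)`;
* `dens_eq_sum_layers`, `smooth_eq_sum_layers` — the corresponding splits of `dens` and `smooth`;
* `negGrad_finset_sum`, `differentiableAt_lateral_layerSum` — `negGrad` of the split.
WHAT THIS IS NOT: stub (B); rung F-C1 not moved.
-/

noncomputable section

namespace Summit.Ventures.Crystal3D.Theorems

open MeasureTheory Set Function Metric Filter Topology
open Literature.MathematicalPhysics.StatisticalMechanics
open Summit.Ventures.Crystal3D.LayerChain (dot3 aVec bPlus bMinus)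
open Summit.Ventures.Crystal3D.Cruxes.StackingLiminf.LayerChainV4 (bump eta dens smooth negGrad)

variable {N : ℕ}

/-- Every configuration inside a Barlow stacking (layer spacing `√(2/3)`) has a layer map. -/
theorem exists_layerMap {σ : ℤ → ℤ} (x : Fin N → EuclideanSpace ℝ (Fin 3))
    (hmem : ∀ i, x i ∈ barlowStacking 1 (Real.sqrt (2 / 3)) σ) :
    ∃ kf : Fin N → ℤ, ∀ i, x i 2 = kf i * Real.sqrt (2 / 3) := by
  choose k a b hk using hmem
  exact ⟨k, fun i => by rw [hk i, barlowPos_apply_two]⟩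

/-- `dot3` is symmetric. -/
theorem dot3_comm (u v : Fin 3 → ℝ) : dot3 u v = dot3 v u := by
  unfold dot3; ring

/-- `dot3` is subtractive in its second argument. -/
theorem dot3_sub_right (u v w : Fin 3 → ℝ) : dot3 u (v - w) = dot3 u v - dot3 u w := by
  unfold dot3; simp only [Pi.sub_apply]; ring

/-- A sum over all indices is the sum over a padded range of layers of the layer sums. -/
theorem sum_eq_sum_range_layers {β : Type*} [AddCommMonoid β] (kf : Fin N → ℤ) (k₀ : ℤ) (m : ℕ)
    (hrange : ∀ i, k₀ ≤ kf i ∧ kf i < k₀ + m) (g : Fin N → β) :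
    ∑ i, g i = ∑ n ∈ Finset.range m, ∑ i ∈ Finset.univ.filter (fun i => kf i = k₀ + n), g i := by
  classical
  have h := Finset.sum_fiberwise_of_maps_to (s := Finset.univ) (t := Finset.range m)
    (g := fun i : Fin N => (kf i - k₀).toNat) (fun i _ => by
      rw [Finset.mem_range]
      have := hrange i
      omega) g
  rw [← h]
  refine Finset.sum_congr rfl fun n _ => ?_
  congr 1
  ext i
  simp only [Finset.mem_filter, Finset.mem_univ, true_and]
  have := hrange i
  omega

/-- The translated bump written coordinatewise. -/
theorem bump_coord_eq (K : ℝ) (y : Fin 3 → ℝ) (p : EuclideanSpace ℝ (Fin 3)) :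
    bump K (fun j => y j - p j) = bump K (y - WithLp.ofLp p) := rfl

/-- `dens` split over a padded range of layers. -/
theorem dens_eq_sum_layers (x : Fin N → EuclideanSpace ℝ (Fin 3)) (K : ℝ) (kf : Fin N → ℤ) (k₀ : ℤ)
    (m : ℕ) (hrange : ∀ i, k₀ ≤ kf i ∧ kf i < k₀ + m) (y : Fin 3 → ℝ) :
    dens x K y = ∑ n ∈ Finset.range m, ∑ i ∈ Finset.univ.filter (fun i => kf i = k₀ + n),
      bump K (y - WithLp.ofLp (x i)) := by
  unfold dens
  rw [sum_eq_sum_range_layers kf k₀ m hrange]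
  rfl

/-- `smooth` split over a padded range of layers: the sum of the lateral averages of the layer densities. -/
theorem smooth_eq_sum_layers (x : Fin N → EuclideanSpace ℝ (Fin 3)) (K : ℝ) {L : ℝ} (hL : 0 < L)
    (kf : Fin N → ℤ) (k₀ : ℤ) (m : ℕ) (hrange : ∀ i, k₀ ≤ kf i ∧ kf i < k₀ + m) (y : Fin 3 → ℝ) :
    smooth x K L y = ∑ n ∈ Finset.range m, ∫ z : ℝ × ℝ, eta L z *
      ∑ i ∈ Finset.univ.filter (fun i => kf i = k₀ + n),
        bump K ((fun j => y j - (![z.1, z.2, 0] : Fin 3 → ℝ) j) - WithLp.ofLp (x i)) := by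
  unfold smooth
  have hι : Continuous fun z : ℝ × ℝ => (fun j => y j - (![z.1, z.2, 0] : Fin 3 → ℝ) j) :=
    continuous_pi fun j => by fin_cases j <;> simp <;> fun_prop
  rw [← integral_finsetSum]
  · refine integral_congr_ae (ae_of_all _ fun z => ?_)
    simp only
    rw [dens_eq_sum_layers x K kf k₀ m hrange, Finset.mul_sum]
  · intro n _
    refine PlateauHeight.integrable_eta_mul hL ?_
    refine continuous_finsetSum _ fun i _ => (continuous_bump K).comp ?_
    exact hι.sub continuous_const

/-- `negGrad` of a finite sum of differentiable functions. -/
theorem negGrad_finset_sum {ι : Type*} (S : Finset ι) (g : ι → (Fin 3 → ℝ) → ℝ) (y : Fin 3 → ℝ)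
    (h : ∀ n ∈ S, DifferentiableAt ℝ (g n) y) :
    negGrad (fun y => ∑ n ∈ S, g n y) y = ∑ n ∈ S, negGrad (g n) y := by
  have hD : fderiv ℝ (fun y => ∑ n ∈ S, g n y) y = ∑ n ∈ S, fderiv ℝ (g n) y :=
    (HasFDerivAt.fun_sum fun n hn => (h n hn).hasFDerivAt).fderiv
  funext j
  unfold negGrad
  rw [hD, _root_.sum_apply, Finset.sum_apply, ← Finset.sum_neg_distrib]

/-- The lateral average of a layer sum is differentiable. -/
theorem differentiableAt_lateral_layerSum (x : Fin N → EuclideanSpace ℝ (Fin 3)) {K L : ℝ} (hK : 0 < K)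
    (hL : 0 < L) (T : Finset (Fin N)) (y : Fin 3 → ℝ) :
    DifferentiableAt ℝ (fun y : Fin 3 → ℝ => ∫ z : ℝ × ℝ, eta L z *
      ∑ i ∈ T, bump K ((fun j => y j - (![z.1, z.2, 0] : Fin 3 → ℝ) j) - WithLp.ofLp (x i))) y := by
  have hF : ContDiff ℝ 1 (fun y : Fin 3 → ℝ => ∑ i ∈ T, bump K (y - WithLp.ofLp (x i))) :=
    ContDiff.sum fun i _ => ((contDiff_bump K).of_le (by norm_num)).comp (contDiff_id.sub contDiff_const)
  have hFs : HasCompactSupport (fun y : Fin 3 → ℝ => ∑ i ∈ T, bump K (y - WithLp.ofLp (x i))) := by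
    refine HasCompactSupport.intro (isCompact_closedBall (0 : Fin 3 → ℝ)
      (K + ∑ i : Fin N, ‖WithLp.ofLp (x i)‖)) fun y hy => ?_
    rw [mem_closedBall, dist_zero_right, not_le] at hy
    refine Finset.sum_eq_zero fun i _ => PlateauHeight.bump_eq_zero_of_norm hK ?_
    have h1 : ‖WithLp.ofLp (x i)‖ ≤ ∑ j : Fin N, ‖WithLp.ofLp (x j)‖ :=
      Finset.single_le_sum (fun j _ => norm_nonneg (WithLp.ofLp (x j))) (Finset.mem_univ i)
    have h2 := norm_sub_norm_le y (WithLp.ofLp (x i))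
    linarith
  exact (hasFDerivAt_lateral (eta L) (continuous_eta L) (PlateauHeight.hasCompactSupport_eta hL) _ hF hFs
    y).differentiableAt

/-- The in-plane bond vectors have sup norm at most `1`. -/
theorem norm_aVec_le (m : Fin 3) : ‖aVec m‖ ≤ 1 :=
  (pi_norm_le_iff_of_nonneg zero_le_one).2 fun j => by
    rw [Real.norm_eq_abs]; exact (ModulatedWulff.abs_frame_le_one m j).1

/-- The `+` up-bond vectors have sup norm at most `1`. -/
theorem norm_bPlus_le (m : Fin 3) : ‖bPlus m‖ ≤ 1 :=
  (pi_norm_le_iff_of_nonneg zero_le_one).2 fun j => by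
    rw [Real.norm_eq_abs]; exact (ModulatedWulff.abs_frame_le_one m j).2.1

/-- The `−` up-bond vectors have sup norm at most `1`. -/
theorem norm_bMinus_le (m : Fin 3) : ‖bMinus m‖ ≤ 1 :=
  (pi_norm_le_iff_of_nonneg zero_le_one).2 fun j => by
    rw [Real.norm_eq_abs]; exact (ModulatedWulff.abs_frame_le_one m j).2.2

/-- The skew direction `b⁺_i − b⁻_i` is horizontal. -/
theorem bPlus_sub_bMinus_apply_two (i : Fin 3) : (bPlus i - bMinus i) 2 = 0 := by
  fin_cases i <;> simp [bPlus, bMinus]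

/-- The lateral part of the skew direction has sup norm at most `2`. -/
theorem norm_bPlus_sub_bMinus_lateral_le (i : Fin 3) :
    ‖((bPlus i - bMinus i) 0, (bPlus i - bMinus i) 1)‖ ≤ 2 := by
  have h3 := ModulatedWulff.sqrt_three_le_two
  have h0 : 0 ≤ Real.sqrt 3 := Real.sqrt_nonneg 3
  rw [Prod.norm_def, max_le_iff, Real.norm_eq_abs, Real.norm_eq_abs]
  fin_cases i <;> simp [bPlus, bMinus, abs_le] <;> (try constructor) <;> (try constructor) <;>
    nlinarith [h3, h0]

end Summit.Ventures.Crystal3D.Theorems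

end
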